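import Summits.ResolutionOfSingularities.ResolutionOfSingularities.Theorems.WallFrames16
import Summits.ResolutionOfSingularities.ResolutionOfSingularities.Theorems.NearCutCompanion3
import Summits.ResolutionOfSingularities.ResolutionOfSingularities.Theorems.NearCutWalls2
import Summits.ResolutionOfSingularities.ResolutionOfSingularities.Theorems.ProximityCutArcLaw
import Summits.ResolutionOfSingularities.ResolutionOfSingularities.Theorems.MaxContactCutBoundaryLedger
import Summits.ResolutionOfSingularities.ResolutionOfSingularities.Theorems.MaxContactCutWallCut
import Summits.ResolutionOfSingularities.ResolutionOfSingularities.Theorems.PlanarGhostDescent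
import Literature.AlgebraicGeometry.Resolution.PointBlowupIFPGiraud
import Literature.AlgebraicGeometry.Resolution.AdicNoetherian
import HarnessLib

/-!
# WallFrames (17/17) — Kollár's wall descent in a polynomial frame; sections: Consequences

Verbatim slice of the farm-checked monolith `WallFrames.lean` of cell `decomp-res`, seat `decomp-res-lens-5`, g35
(sha256 7405a21d81d102a4…, monolith lines 3878–3911); one namespace `Summit.ResolutionOfSingularities.ResolutionOfSingularities.Theorems.WallFrames` across the
slices, imports chained.  The monolith's module docstring (laws W1–W7, mechanism, novelty, honest placement) is
reproduced in slice 1; the main theorem `balancedWallPort_holds : WallCut.BalancedWallPort` (hypothesis-free) and the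
host-route corollary `ecBalancedWallPort_holds` (aside item 27368 of route MaxContactCut) are in slice 16/17.
-/

open MvPolynomial Finset
open scoped BigOperators
open Literature.AlgebraicGeometry.Resolution
open Literature.AlgebraicGeometry.Resolution.Hauser2010
open Literature.AlgebraicGeometry.Resolution.PointBlowup
open Literature.AlgebraicGeometry.Resolution.HauserPerlega2024

namespace Summit.ResolutionOfSingularities.ResolutionOfSingularities.Theorems.WallFrames

variable {σ : Type*} [Fintype σ] [DecidableEq σ] {K : Type*} [Field K]

section Consequences

/-- `ExtinctionCut.KollarWallPort` holds (via `WallCut.kollarWallPort_of_balancedWallPort`). -/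
theorem kollarWallPort_holds : ExtinctionCut.KollarWallPort :=
  WallCut.kollarWallPort_of_balancedWallPort balancedWallPort_holds

/-- The tame balanced STRICT cell holds (via `WallCut.noTameBalancedStrictTails_of_port`). -/
theorem noTameBalancedStrictTailsDeep_holds : WallCut.NoTameBalancedStrictTailsDeep :=
  WallCut.noTameBalancedStrictTails_of_port balancedWallPort_holds

/-- The balanced BOUNDARY cell holds (via `WallCut.noBalancedBoundaryTails_of_balancedWallPort`). -/
theorem noBalancedBoundaryTailsDeep_holds : FreezeCut.NoBalancedBoundaryTailsDeep :=
  WallCut.noBalancedBoundaryTails_of_balancedWallPort balancedWallPort_holds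

/-- **EXACT RESIDUAL OF THE HOST ASIDE 31770, HYPOTHESIS-FREE**: `DefectWalksDeep ⟺ LOSSY ∧ WILD-BALANCED`
(`WallCut.defectWalksDeep_iff_of_port` + `ProximityCut.noFreePointTailsDeep_holds` +
`GhostDescent.noHighPlanarJointTailsDeep_holds` + the port). -/
theorem defectWalksDeep_iff_lossy_wild :
    Summit.ResolutionOfSingularities.ResolutionOfSingularities.Theses.MaxContactCut.DefectWalksDeep ↔
      WallCut.NoLossyStrictTailsDeep ∧ WallCut.NoWildBalancedStrictTailsDeep :=
  (WallCut.defectWalksDeep_iff_of_port balancedWallPort_holds).trans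
    ⟨fun h => ⟨h.2.2.1, h.2.2.2⟩, fun h =>
      ⟨ProximityCut.noFreePointTailsDeep_holds, GhostDescent.noHighPlanarJointTailsDeep_holds, h.1, h.2⟩⟩

end Consequences

/-! ## §14 Hygiene rider (item 33395): the loaded-critical-plateaux cell by the landed one-liner -/

/-- **`MaxContactCut.BLNoLoadedCriticalPlateauxDeep` (item stmt-ResolutionOfSingularities-33395) HOLDS**, hyp-free:
the landed proximity arc law `ProximityCut.noFreePointTailsDeep_holds` fed into the landed wiring
`ProximityCut.loaded_of_freeTails`. [COSTUME rider: by name] -/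
theorem blNoLoadedCriticalPlateauxDeep_holds :
    Summit.ResolutionOfSingularities.ResolutionOfSingularities.Theses.MaxContactCut.BLNoLoadedCriticalPlateauxDeep :=
  ProximityCut.loaded_of_freeTails ProximityCut.noFreePointTailsDeep_holds

end Summit.ResolutionOfSingularities.ResolutionOfSingularities.Theorems.WallFrames
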